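import Summits.ABC.IUTFork.Repair.RHToptKnapsackDual
import HarnessLib

/-!
# R-H D-0121 (1)(b) T-OPTIMALITY — the fractional-knapsack LP of an averaging scheme, part 2: EXISTENCE of the greedy certificate
# for every finite table (strong duality proper; PROOF-ONLY, 0 definitions)

abc-iut cell, rung LADDER-ABC:A2.RESCUE.H; seat abc-iut-topt-pv-2 (D0121-SPEC v0 §1.2 «the fractional-knapsack weak+strong duality over a finite cell
family in exact ℚ/ℝ arithmetic … and the complementary-slackness characterisation of every optimal ω»). Sequel of
`Repair/RHToptKnapsackDual.lean` (p488805: §1 weak duality `kept_le_dual`, §2 complementary slackness `kept_eq_dual_iff` + strong duality in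
CERTIFICATE form `optimal_of_complementarySlackness`, §3 the FORCED WEIGHT LAW `forcedLaw_of_optimal`); same LP, same notation:
    (P) maximise `Σ_{c∈s} ω c·t c` over `0 ≤ ω ≤ 1` subject to `Σ_{c∈s} ω c·ŝ c ≥ 0`;   (D) `g(y) = Σ_{c∈s} max(t c + y·ŝ c, 0)`, `y ≥ 0`.
WHAT IS PROVED HERE (§4): for EVERY finite table with non-negative masses `t ≥ 0` (the cell's `cellTrivialCost ≥ 0`) a certificate `(ω⋆, y)` as
consumed by §2/§3 EXISTS — `exists_certificate` — so `max (P) = min_{y ≥ 0} g(y)` is attained on both sides (`exists_kept_eq_dual`) and the forced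
weight law of §3 is never vacuous: the per-datum LP-2 optimum the kit tabulates is characterised in the kernel with no appeal to an LP solver.
The witness is the GREEDY SCHEME: with surplus `B := Σ_{ŝ ≥ 0} ŝ`, if the total debt `Σ_{ŝ < 0} (−ŝ) ≤ B` take `y = 0`, `ω⋆ ≡ 1`; otherwise
`y :=` the LEAST deficit ratio `t c/(−ŝ c)` whose strict upper set fits in `B` (`exists_threshold`), `ω⋆ = 1` on surplus cells and on deficit
cells of ratio `> y`, `ω⋆ = θ := (B − A)/Tie ∈ [0,1]` on the tie cells of ratio `= y` (`A` = debt of ratio `> y`, `Tie` = debt of ratio `= y`,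
`A ≤ B < A + Tie`), `ω⋆ = 0` below; its netting sum is `B − A − θ·Tie = 0` (`greedy_net_eq`, `debt_ge_eq_debt_gt_add_tie`).
HONEST FRAMING: elementary LP arithmetic about a finite table of numbers; nothing here asserts that abc is proved or refuted, or that
[IUTchIII] Cor. 3.12 / [IUTchIV] Thm. 1.10 holds or fails at any datum, or takes a side on any author; computed ≠ proved; typed ≠ proved.
[folklore] throughout (fractional knapsack, Dantzig 1957; LP duality).
-/

namespace Summit.ABC.IUTFork.Repair.RH.ToptKnapsack

open Finset

variable {ι 𝕜 : Type*} [Field 𝕜] [LinearOrder 𝕜] [IsStrictOrderedRing 𝕜]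

/-! ## §4. EXISTENCE of a certificate for every finite table (strong duality proper): the greedy threshold

For non-negative masses `t ≥ 0` the greedy construction always produces a pair `(ω⋆, y)` as in §2: if the deficit cells' total debt
`Σ_{ŝ<0} (−ŝ)` fits in the surplus `B := Σ_{ŝ≥0} ŝ`, take `y = 0`, `ω⋆ ≡ 1`; otherwise let `y` be the LEAST ratio `t c/(−ŝ c)` of a deficit cell such
that the cells of strictly larger ratio fit in `B`, keep those whole, drop the cells of smaller ratio, and split the remaining budget evenly over
the tie cells of ratio exactly `y`. Hence `max (P) = min_{y ≥ 0} g(y)` is ATTAINED on both sides for every finite table — the LP-2 value the kit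
tabulates per datum exists and is characterised by §2/§3 with no appeal to a general LP solver. -/

section Existence

variable {s : Finset ι} {t ŝ : ι → 𝕜}

omit [IsStrictOrderedRing 𝕜] in
/-- **The greedy threshold exists.** For a finite family `D` with masses `m` and ratios `ρ`, and a budget `0 ≤ B < Σ_D m`, there is a ratio value
`y = ρ c₀` (`c₀ ∈ D`) such that the cells of ratio `> y` weigh at most `B` while the cells of ratio `≥ y` weigh more than `B`. [folklore] -/
theorem exists_threshold (D : Finset ι) (m ρ : ι → 𝕜) (B : 𝕜) (hB : 0 ≤ B) (hlt : B < ∑ c ∈ D, m c) :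
    ∃ y ∈ D.image ρ, ∑ c ∈ D.filter (fun c => y < ρ c), m c ≤ B ∧ B < ∑ c ∈ D.filter (fun c => y ≤ ρ c), m c := by
  have hDne : D.Nonempty := by
    rcases D.eq_empty_or_nonempty with h | h
    · rw [h, Finset.sum_empty] at hlt
      exact absurd hlt (not_lt.mpr hB)
    · exact h
  have hRne : (D.image ρ).Nonempty := hDne.image ρ
  -- admissible ratios: those whose strict upper set fits in the budget; the largest ratio is admissible (its strict upper set is empty)
  obtain ⟨R', hR'⟩ : ∃ R' : Finset 𝕜, R' = (D.image ρ).filter (fun r => ∑ c ∈ D.filter (fun c => r < ρ c), m c ≤ B) := ⟨_, rfl⟩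
  have hmax : (D.image ρ).max' hRne ∈ R' := by
    rw [hR', Finset.mem_filter]
    refine ⟨Finset.max'_mem _ hRne, ?_⟩
    have hzero : ∑ c ∈ D.filter (fun c => (D.image ρ).max' hRne < ρ c), m c = 0 :=
      Finset.sum_eq_zero fun c hc => by
        obtain ⟨hcD, hclt⟩ := Finset.mem_filter.mp hc
        exact absurd hclt (not_lt.mpr (Finset.le_max' _ (ρ c) (Finset.mem_image_of_mem ρ hcD)))
    rw [hzero]
    exact hB
  have hR'ne : R'.Nonempty := ⟨_, hmax⟩
  obtain ⟨y, hy⟩ : ∃ y : 𝕜, y = R'.min' hR'ne := ⟨_, rfl⟩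
  have hymem : y ∈ D.image ρ ∧ ∑ c ∈ D.filter (fun c => y < ρ c), m c ≤ B := by
    have h := Finset.min'_mem R' hR'ne
    rw [← hy, hR', Finset.mem_filter] at h
    exact h
  refine ⟨y, hymem.1, hymem.2, ?_⟩
  by_cases hlow : (D.filter (fun c => ρ c < y)).Nonempty
  · -- `r'` := the largest ratio below `y`; it is NOT admissible (it lies below the least admissible ratio), and its strict upper set is `{ρ ≥ y}`
    have hlow' : ((D.filter (fun c => ρ c < y)).image ρ).Nonempty := hlow.image ρ
    obtain ⟨r', hr'⟩ : ∃ r' : 𝕜, r' = ((D.filter (fun c => ρ c < y)).image ρ).max' hlow' := ⟨_, rfl⟩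
    have hr'mem : r' ∈ (D.filter (fun c => ρ c < y)).image ρ := by
      rw [hr']
      exact Finset.max'_mem _ hlow'
    obtain ⟨c₁, hc₁, hc₁r⟩ := Finset.mem_image.mp hr'mem
    have hr'lt : r' < y := by
      rw [← hc₁r]
      exact (Finset.mem_filter.mp hc₁).2
    have hr'R : r' ∈ D.image ρ := by
      rw [← hc₁r]
      exact Finset.mem_image_of_mem ρ (Finset.mem_filter.mp hc₁).1
    have hgt : B < ∑ c ∈ D.filter (fun c => r' < ρ c), m c := by
      by_contra hle
      have hmem : r' ∈ R' := by
        rw [hR', Finset.mem_filter]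
        exact ⟨hr'R, not_lt.mp hle⟩
      have hyr : y ≤ r' := hy.le.trans (Finset.min'_le _ r' hmem)
      exact absurd hr'lt (not_lt.mpr hyr)
    have hfilt : D.filter (fun c => r' < ρ c) = D.filter (fun c => y ≤ ρ c) := by
      refine Finset.filter_congr fun c hc => ⟨fun h => ?_, fun h => hr'lt.trans_le h⟩
      by_contra hcy
      have hm : ρ c ∈ (D.filter (fun c => ρ c < y)).image ρ :=
        Finset.mem_image_of_mem ρ (Finset.mem_filter.mpr ⟨hc, not_le.mp hcy⟩)
      have hcr : ρ c ≤ r' := (Finset.le_max' _ _ hm).trans_eq hr'.symm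
      exact absurd h (not_lt.mpr hcr)
    rwa [hfilt] at hgt
  · have hall : D.filter (fun c => y ≤ ρ c) = D :=
      Finset.filter_true_of_mem fun c hc => not_lt.mp fun h => hlow ⟨c, Finset.mem_filter.mpr ⟨hc, h⟩⟩
    rw [hall]
    exact hlt

omit [IsStrictOrderedRing 𝕜] in
/-- The netting sum of the GREEDY SCHEME at threshold `y` with tie fraction `θ`: surplus cells whole (`B := Σ_{ŝ ≥ 0} ŝ`), deficit cells of
ratio `> y` whole (debt `A`), tie cells at `θ` (debt `θ·Tie`), the rest dropped: `Σ ω ŝ = B − A − θ·Tie`. [folklore] -/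
theorem greedy_net_eq (s : Finset ι) (t ŝ : ι → 𝕜) (y θ : 𝕜) :
    ∑ c ∈ s, (if 0 ≤ ŝ c then 1 else if y < t c / (-ŝ c) then 1 else if y ≤ t c / (-ŝ c) then θ else 0) * ŝ c =
      ∑ c ∈ s.filter (fun c => 0 ≤ ŝ c), ŝ c
        - ∑ c ∈ (s.filter (fun c => ¬ 0 ≤ ŝ c)).filter (fun c => y < t c / (-ŝ c)), (-ŝ c)
        - θ * ∑ c ∈ ((s.filter (fun c => ¬ 0 ≤ ŝ c)).filter (fun c => ¬ y < t c / (-ŝ c))).filter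
            (fun c => y ≤ t c / (-ŝ c)), (-ŝ c) := by
  rw [← Finset.sum_filter_add_sum_filter_not s (fun c => 0 ≤ ŝ c),
    ← Finset.sum_filter_add_sum_filter_not (s.filter fun c => ¬ 0 ≤ ŝ c) (fun c => y < t c / (-ŝ c)),
    ← Finset.sum_filter_add_sum_filter_not ((s.filter fun c => ¬ 0 ≤ ŝ c).filter fun c => ¬ y < t c / (-ŝ c))
      (fun c => y ≤ t c / (-ŝ c))]
  have hL : ∑ c ∈ s.filter (fun c => 0 ≤ ŝ c),
      (if 0 ≤ ŝ c then 1 else if y < t c / (-ŝ c) then 1 else if y ≤ t c / (-ŝ c) then θ else 0) * ŝ c =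
        ∑ c ∈ s.filter (fun c => 0 ≤ ŝ c), ŝ c :=
    Finset.sum_congr rfl fun c hc => by rw [if_pos (Finset.mem_filter.mp hc).2, one_mul]
  have h1 : ∑ c ∈ (s.filter (fun c => ¬ 0 ≤ ŝ c)).filter (fun c => y < t c / (-ŝ c)),
      (if 0 ≤ ŝ c then 1 else if y < t c / (-ŝ c) then 1 else if y ≤ t c / (-ŝ c) then θ else 0) * ŝ c =
        -∑ c ∈ (s.filter (fun c => ¬ 0 ≤ ŝ c)).filter (fun c => y < t c / (-ŝ c)), (-ŝ c) := by
    rw [← Finset.sum_neg_distrib]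
    refine Finset.sum_congr rfl fun c hc => ?_
    obtain ⟨hcD, hcy⟩ := Finset.mem_filter.mp hc
    rw [if_neg (Finset.mem_filter.mp hcD).2, if_pos hcy, one_mul, neg_neg]
  have h2 : ∑ c ∈ ((s.filter (fun c => ¬ 0 ≤ ŝ c)).filter (fun c => ¬ y < t c / (-ŝ c))).filter (fun c => y ≤ t c / (-ŝ c)),
      (if 0 ≤ ŝ c then 1 else if y < t c / (-ŝ c) then 1 else if y ≤ t c / (-ŝ c) then θ else 0) * ŝ c =
        -(θ * ∑ c ∈ ((s.filter (fun c => ¬ 0 ≤ ŝ c)).filter (fun c => ¬ y < t c / (-ŝ c))).filter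
          (fun c => y ≤ t c / (-ŝ c)), (-ŝ c)) := by
    rw [Finset.mul_sum, ← Finset.sum_neg_distrib]
    refine Finset.sum_congr rfl fun c hc => ?_
    obtain ⟨hcD', hcle⟩ := Finset.mem_filter.mp hc
    obtain ⟨hcD, hcy⟩ := Finset.mem_filter.mp hcD'
    rw [if_neg (Finset.mem_filter.mp hcD).2, if_neg hcy, if_pos hcle]
    ring
  have h3 : ∑ c ∈ ((s.filter (fun c => ¬ 0 ≤ ŝ c)).filter (fun c => ¬ y < t c / (-ŝ c))).filter (fun c => ¬ y ≤ t c / (-ŝ c)),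
      (if 0 ≤ ŝ c then 1 else if y < t c / (-ŝ c) then 1 else if y ≤ t c / (-ŝ c) then θ else 0) * ŝ c = 0 := by
    refine Finset.sum_eq_zero fun c hc => ?_
    obtain ⟨hcD', hcle⟩ := Finset.mem_filter.mp hc
    obtain ⟨hcD, hcy⟩ := Finset.mem_filter.mp hcD'
    rw [if_neg (Finset.mem_filter.mp hcD).2, if_neg hcy, if_neg hcle, zero_mul]
  rw [hL, h1, h2, h3]
  ring

omit [IsStrictOrderedRing 𝕜] in
/-- The tie mass: the debt of the cells of ratio `≥ y` is the debt of those of ratio `> y` plus the debt of those of ratio exactly `y`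
(written as the double filter `¬ (y < ρ)`, `y ≤ ρ` used by `greedy_net_eq`). [folklore] -/
theorem debt_ge_eq_debt_gt_add_tie (D : Finset ι) (m ρ : ι → 𝕜) (y : 𝕜) :
    ∑ c ∈ D.filter (fun c => y ≤ ρ c), m c =
      ∑ c ∈ D.filter (fun c => y < ρ c), m c + ∑ c ∈ (D.filter (fun c => ¬ y < ρ c)).filter (fun c => y ≤ ρ c), m c := by
  have e1 : D.filter (fun c => y < ρ c) = (D.filter (fun c => y ≤ ρ c)).filter (fun c => y < ρ c) := by
    ext c
    simp only [Finset.mem_filter]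
    exact ⟨fun h => ⟨⟨h.1, h.2.le⟩, h.2⟩, fun h => ⟨h.1.1, h.2⟩⟩
  have e2 : (D.filter (fun c => ¬ y < ρ c)).filter (fun c => y ≤ ρ c) = (D.filter (fun c => y ≤ ρ c)).filter (fun c => ¬ y < ρ c) := by
    ext c
    simp only [Finset.mem_filter]
    exact ⟨fun h => ⟨⟨h.1.1, h.2⟩, h.1.2⟩, fun h => ⟨⟨h.1.1, h.2⟩, h.1.2⟩⟩
  rw [e1, e2]
  exact (Finset.sum_filter_add_sum_filter_not _ _ _).symm

/-- **STRONG DUALITY / EXISTENCE OF THE GREEDY CERTIFICATE.** For every finite table with `t ≥ 0` there are a multiplier `y ≥ 0` and a feasible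
scheme `ω⋆` (`0 ≤ ω⋆ ≤ 1`, `Σ ω⋆ ŝ ≥ 0`) satisfying complementary slackness at `y` — hence (§2) `ω⋆` is optimal for (P), `Σ ω⋆ t = g(y) =
min_{y' ≥ 0} g(y')`, and (§3) every optimal scheme is `1` above / `0` below the ratio threshold `y`. The witness is the greedy scheme: surplus
cells and deficit cells of ratio `> y` whole, ratio `< y` dropped, the tie cells of ratio `= y` at the common fraction
`θ = (B − A)/(A⁺ − A) ∈ [0,1]` (`B` the surplus, `A`/`A⁺` the debt of the cells of ratio `> y`/`≥ y`). [folklore] -/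
theorem exists_certificate (s : Finset ι) (t ŝ : ι → 𝕜) (ht : ∀ c ∈ s, 0 ≤ t c) :
    ∃ (y : 𝕜) (ω : ι → 𝕜), 0 ≤ y ∧ (∀ c ∈ s, 0 ≤ ω c) ∧ (∀ c ∈ s, ω c ≤ 1) ∧ 0 ≤ ∑ c ∈ s, ω c * ŝ c ∧
      y * ∑ c ∈ s, ω c * ŝ c = 0 ∧
        ∀ c ∈ s, (0 < t c + y * ŝ c → ω c = 1) ∧ (t c + y * ŝ c < 0 → ω c = 0) := by
  -- surplus `B`, deficit cells `D`
  obtain ⟨B, hBdef⟩ : ∃ B : 𝕜, B = ∑ c ∈ s.filter (fun c => 0 ≤ ŝ c), ŝ c := ⟨_, rfl⟩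
  obtain ⟨D, hDdef⟩ : ∃ D : Finset ι, D = s.filter (fun c => ¬ 0 ≤ ŝ c) := ⟨_, rfl⟩
  have hB : 0 ≤ B := by
    rw [hBdef]
    exact Finset.sum_nonneg fun c hc => (Finset.mem_filter.mp hc).2
  have hDs : ∀ c ∈ D, c ∈ s ∧ ŝ c < 0 := fun c hc => by
    rw [hDdef, Finset.mem_filter] at hc
    exact ⟨hc.1, not_le.mp hc.2⟩
  by_cases hcase : ∑ c ∈ D, (-ŝ c) ≤ B
  · -- CASE 1: the whole debt fits in the surplus: keep everything, `y = 0`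
    have hnet : 0 ≤ ∑ c ∈ s, (1 : 𝕜) * ŝ c := by
      have h1 : ∑ c ∈ s, (1 : 𝕜) * ŝ c = ∑ c ∈ s, ŝ c := Finset.sum_congr rfl fun c _ => one_mul _
      have hDsum : ∑ c ∈ D, ŝ c = -∑ c ∈ D, -ŝ c := by rw [Finset.sum_neg_distrib, neg_neg]
      rw [h1, ← Finset.sum_filter_add_sum_filter_not s (fun c => 0 ≤ ŝ c), ← hBdef, ← hDdef, hDsum]
      linarith
    refine ⟨0, fun _ => 1, le_rfl, fun _ _ => zero_le_one, fun _ _ => le_rfl, hnet, by rw [zero_mul],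
      fun c hc => ⟨fun _ => rfl, fun h => ?_⟩⟩
    rw [zero_mul, add_zero] at h
    exact absurd h (not_lt.mpr (ht c hc))
  · -- CASE 2: the debt exceeds the surplus: greedy threshold `y` among the deficit ratios `ρ = t/(−ŝ)`
    have hcase' : B < ∑ c ∈ D, (-ŝ c) := not_le.mp hcase
    obtain ⟨y, hyR, hA, hA'⟩ := exists_threshold D (fun c => -ŝ c) (fun c => t c / (-ŝ c)) B hB hcase'
    obtain ⟨c₀, hc₀, hc₀y⟩ := Finset.mem_image.mp hyR
    have hy0 : 0 ≤ y := by
      rw [← hc₀y]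
      exact div_nonneg (ht c₀ (hDs c₀ hc₀).1) (neg_nonneg.mpr (hDs c₀ hc₀).2.le)
    -- debts `A` (ratio `> y`) and `Tie` (ratio `= y`), tie fraction `θ`
    obtain ⟨A, hAdef⟩ : ∃ A : 𝕜, A = ∑ c ∈ D.filter (fun c => y < t c / (-ŝ c)), (-ŝ c) := ⟨_, rfl⟩
    obtain ⟨Tie, hTiedef⟩ : ∃ T₀ : 𝕜,
        T₀ = ∑ c ∈ (D.filter (fun c => ¬ y < t c / (-ŝ c))).filter (fun c => y ≤ t c / (-ŝ c)), (-ŝ c) := ⟨_, rfl⟩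
    rw [← hAdef] at hA
    rw [debt_ge_eq_debt_gt_add_tie, ← hAdef, ← hTiedef] at hA'
    have hTiepos : 0 < Tie := by linarith
    obtain ⟨θ, hθdef⟩ : ∃ θ : 𝕜, θ = (B - A) / Tie := ⟨_, rfl⟩
    have hθ0 : 0 ≤ θ := by
      rw [hθdef]
      exact div_nonneg (sub_nonneg.mpr hA) hTiepos.le
    have hθ1 : θ ≤ 1 := by
      rw [hθdef, div_le_one hTiepos]
      linarith
    have hθTie : θ * Tie = B - A := by
      rw [hθdef]
      exact div_mul_cancel₀ _ hTiepos.ne'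
    -- the greedy scheme and its netting sum `= 0`
    have hnet : ∑ c ∈ s, (if 0 ≤ ŝ c then 1 else if y < t c / (-ŝ c) then 1 else if y ≤ t c / (-ŝ c) then θ else 0) * ŝ c = 0 := by
      rw [greedy_net_eq, ← hBdef, ← hDdef, ← hAdef, ← hTiedef, hθTie]
      ring
    refine ⟨y, fun c => if 0 ≤ ŝ c then 1 else if y < t c / (-ŝ c) then 1 else if y ≤ t c / (-ŝ c) then θ else 0,
      hy0, fun c _ => ?_, fun c _ => ?_, hnet.symm.le, by rw [hnet, mul_zero], fun c hc => ?_⟩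
    · -- `0 ≤ ω`
      show 0 ≤ (if 0 ≤ ŝ c then 1 else if y < t c / (-ŝ c) then 1 else if y ≤ t c / (-ŝ c) then θ else 0)
      split_ifs
      exacts [zero_le_one, zero_le_one, hθ0, le_rfl]
    · -- `ω ≤ 1`
      show (if 0 ≤ ŝ c then 1 else if y < t c / (-ŝ c) then 1 else if y ≤ t c / (-ŝ c) then θ else 0) ≤ 1
      split_ifs
      exacts [le_rfl, le_rfl, hθ1, zero_le_one]
    · -- complementary slackness at `y`
      show (0 < t c + y * ŝ c →
          (if 0 ≤ ŝ c then 1 else if y < t c / (-ŝ c) then 1 else if y ≤ t c / (-ŝ c) then θ else 0) = 1) ∧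
        (t c + y * ŝ c < 0 →
          (if 0 ≤ ŝ c then 1 else if y < t c / (-ŝ c) then 1 else if y ≤ t c / (-ŝ c) then θ else 0) = 0)
      by_cases hsc : 0 ≤ ŝ c
      · rw [if_pos hsc]
        exact ⟨fun _ => rfl, fun h => absurd h (not_lt.mpr (by nlinarith [ht c hc, mul_nonneg hy0 hsc]))⟩
      · rw [if_neg hsc]
        have hs : ŝ c < 0 := not_le.mp hsc
        refine ⟨fun h => ?_, fun h => ?_⟩
        · rw [if_pos ((reducedCost_pos_iff_lt_ratio hs).mp h)]
        · have hlt : t c / (-ŝ c) < y := (reducedCost_neg_iff_ratio_lt hs).mp h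
          rw [if_neg (not_lt.mpr hlt.le), if_neg (not_le.mpr hlt)]

/-- **STRONG DUALITY, value form**: for every finite table with `t ≥ 0` some feasible scheme ATTAINS some dual value:
`∃ y ≥ 0, ∃ ω feasible, Σ ω t = g(y)`; by weak duality (`kept_le_dual`) this common value is `max (P) = min (D)`. [folklore] -/
theorem exists_kept_eq_dual (s : Finset ι) (t ŝ : ι → 𝕜) (ht : ∀ c ∈ s, 0 ≤ t c) :
    ∃ (y : 𝕜) (ω : ι → 𝕜), 0 ≤ y ∧ (∀ c ∈ s, 0 ≤ ω c) ∧ (∀ c ∈ s, ω c ≤ 1) ∧ 0 ≤ ∑ c ∈ s, ω c * ŝ c ∧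
      ∑ c ∈ s, ω c * t c = ∑ c ∈ s, max (t c + y * ŝ c) 0 := by
  obtain ⟨y, ω, hy, h0, h1, hnet, htight, hcs⟩ := exists_certificate s t ŝ ht
  exact ⟨y, ω, hy, h0, h1, hnet, (kept_eq_dual_iff h0 h1 hnet hy).mpr ⟨htight, hcs⟩⟩

end Existence

end Summit.ABC.IUTFork.Repair.RH.ToptKnapsack
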